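import Summits.CriticalPhenomena.CardyFormulaZ2.Theorems.CardySelfRefinementLagHandOffNoIdleAuxCount
import HarnessLib

/-!
# No one-sided touching of a fixed line by the limit interface, part 4: windows on the line
and the decay of the union bound

Helper file for the registered stubs `stub_quadTransfer_noTouchRe` / `stub_quadTransfer_noTouchIm`
of line `hitting-tournament` of crux `LagHandOff` (stmt-CriticalPhenomena-10268); elementary
bookkeeping of the first-moment estimate, free of percolation and of curves:

* `exists_int_window` — every point within height `ε` of the line `{Re (ū z) = a}` (`‖u‖ = 1`)
  and of norm `< Rad` is within `2ε` of one of the `2N + 1` grid points `u (a + i ε I)`,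
  `|i| ≤ N`, once `Rad/ε ≤ N`;
* `re_conj_mul_sub_shift`, `re_conj_mul_gridPoint` — heights relative to the shifted centres
  `u (a + i ε I) + h u`;
* `tendsto_touchBound_atTop` — along `ε_k = ε₀ 2^{-k}`, `N_k = ⌈Rad/ε_k⌉`, the union bound
  `(2N_k + 1) C (1024 ε_k/d)^{1+α}` of the half-plane three-arm estimate over the windows tends
  to `0` (`α > 0`): an extra arm beyond the boundary two-arm exponent `1` beats the number of
  windows.

References: G. F. Lawler, O. Schramm, W. Werner, Electron. J. Probab. 7 (2002), App. A;
M. Aizenman, A. Burchard, Duke Math. J. 99 (1999), §2.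
-/

noncomputable section

open Filter Set Topology Metric
open scoped ENNReal

namespace Summit.CriticalPhenomena.CardyFormulaZ2.Cruxes.LagHandOff.HittingTournament

/-! ### The grid of windows on the line -/

/-- **Every point within height `ε` of the line `{Re (ū z) = a}` and of norm `< Rad` is within
`2ε` of a grid point `u (a + i ε I)`, `|i| ≤ N`**, once `Rad/ε ≤ N`. -/
theorem exists_int_window {u : ℂ} (hu : ‖u‖ = 1) {a ε Rad : ℝ} (hε : 0 < ε) {z : ℂ}
    (hz : |(starRingEnd ℂ u * z).re - a| < ε) (hzR : ‖z‖ < Rad) {N : ℕ} (hN : Rad / ε ≤ N) :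
    ∃ i : ℤ, -(N : ℤ) ≤ i ∧ i ≤ N ∧
      dist z (u * ((a : ℂ) + (((i : ℝ) * ε : ℝ) : ℂ) * Complex.I)) < 2 * ε := by
  set w : ℂ := starRingEnd ℂ u * z with hw
  have huu : u * starRingEnd ℂ u = 1 := by
    rw [Complex.mul_conj']; simp [hu]
  have hzw : z = u * w := by rw [hw, ← mul_assoc, huu, one_mul]
  have hnw : ‖w‖ = ‖z‖ := by rw [hw, norm_mul, Complex.norm_conj, hu, one_mul]
  set i : ℤ := round (w.im / ε) with hi
  have hround : |w.im / ε - i| ≤ 1 / 2 := abs_sub_round _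
  have him : |w.im| < Rad := (Complex.abs_im_le_norm w).trans_lt (by rw [hnw]; exact hzR)
  have hiq : |w.im / ε| < N := by
    rw [abs_div, abs_of_pos hε]
    calc |w.im| / ε < Rad / ε := div_lt_div_of_pos_right him hε
      _ ≤ N := hN
  have hiabs : |(i : ℝ)| < N + 1 := by
    have := abs_sub_abs_le_abs_sub (i : ℝ) (w.im / ε)
    rw [abs_sub_comm] at this
    linarith
  rw [abs_lt] at hiabs
  refine ⟨i, ?_, ?_, ?_⟩
  · have h1 : ((-(N : ℤ) - 1 : ℤ) : ℝ) < i := by push_cast; linarith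
    have h2 : -(N : ℤ) - 1 < i := by exact_mod_cast h1
    omega
  · have h1 : (i : ℝ) < ((N + 1 : ℤ) : ℝ) := by push_cast; linarith
    have h2 : i < (N : ℤ) + 1 := by exact_mod_cast h1
    omega
  · have hdiff : z - u * ((a : ℂ) + (((i : ℝ) * ε : ℝ) : ℂ) * Complex.I) =
        u * (w - ((a : ℂ) + (((i : ℝ) * ε : ℝ) : ℂ) * Complex.I)) := by
      rw [hzw]; ring
    rw [Complex.dist_eq, hdiff, norm_mul, hu, one_mul]
    have hre : (w - ((a : ℂ) + (((i : ℝ) * ε : ℝ) : ℂ) * Complex.I)).re = w.re - a := by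
      simp
    have him' : (w - ((a : ℂ) + (((i : ℝ) * ε : ℝ) : ℂ) * Complex.I)).im = w.im - i * ε := by
      simp
    have h1 := Complex.norm_le_abs_re_add_abs_im (w - ((a : ℂ) + (((i : ℝ) * ε : ℝ) : ℂ) * Complex.I))
    rw [hre, him'] at h1
    have h2 : |w.im - i * ε| ≤ ε / 2 := by
      have : w.im - i * ε = (w.im / ε - i) * ε := by field_simp
      rw [this, abs_mul, abs_of_pos hε]
      nlinarith
    have h3 : |w.re - a| < ε := hz
    linarith

/-- Heights relative to the shifted centre `x = p + h u` of a point `p` of the line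
`{Re (ū z) = a}`: `Re (ū (z - x)) = Re (ū z) - a - h`. -/
theorem re_conj_mul_sub_shift {u : ℂ} (hu : ‖u‖ = 1) {a h : ℝ} {p : ℂ}
    (hp : (starRingEnd ℂ u * p).re = a) (z : ℂ) :
    (starRingEnd ℂ u * (z - (p + (h : ℂ) * u))).re = (starRingEnd ℂ u * z).re - a - h := by
  have h1 : starRingEnd ℂ u * u = 1 := by
    rw [Complex.conj_mul']; simp [hu]
  have : starRingEnd ℂ u * (z - (p + (h : ℂ) * u)) =
      starRingEnd ℂ u * z - starRingEnd ℂ u * p - (h : ℂ) * (starRingEnd ℂ u * u) := by ring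
  rw [this, h1, mul_one, Complex.sub_re, Complex.sub_re, Complex.ofReal_re, hp]

/-- The grid point `u (a + s I)` (`s` real) lies on the line: `Re (ū · u (a + s I)) = a`. -/
theorem re_conj_mul_gridPoint {u : ℂ} (hu : ‖u‖ = 1) (a s : ℝ) :
    (starRingEnd ℂ u * (u * ((a : ℂ) + ((s : ℝ) : ℂ) * Complex.I))).re = a := by
  have h1 : starRingEnd ℂ u * u = 1 := by
    rw [Complex.conj_mul']; simp [hu]
  rw [← mul_assoc, h1, one_mul]
  simp

/-! ### Decay of the bound along dyadic closeness scales -/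

/-- **The bound of part 4 decays along the dyadic scales** `ε_k = ε₀ 2^{-k}`,
`N_k = ⌈Rad/ε_k⌉`: with `x = 2^{-k}` and `1024 ε₀ ≤ d`,
`(2N_k + 1) C (1024 ε_k/d)^{1+α} ≤ C (2048 Rad/d + 3) (1024 ε₀/d)^α x^α → 0` (`α > 0`). -/
theorem tendsto_touchBound_atTop {C α d ε₀ Rad : ℝ} (hC : 0 ≤ C) (hα : 0 < α) (hd : 0 < d)
    (hε₀ : 0 < ε₀) (hε₀d : 1024 * ε₀ ≤ d) (hRad : 0 ≤ Rad) {ε : ℕ → ℝ} {N : ℕ → ℕ}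
    (hε : ∀ k, ε k = ε₀ * (1 / 2) ^ k) (hN : ∀ k, N k = ⌈Rad / ε k⌉₊) :
    Tendsto (fun k => ((2 * N k + 1 : ℕ) : ℝ≥0∞) *
      ENNReal.ofReal (C * (1024 * ε k / d) ^ (1 + α))) atTop (𝓝 0) := by
  set x : ℕ → ℝ := fun k => (1 / 2 : ℝ) ^ k with hx
  have hx0 : ∀ k, 0 < x k := fun k => by simp only [hx]; positivity
  have hx1 : ∀ k, x k ≤ 1 := fun k => by
    simp only [hx]; exact pow_le_one₀ (by norm_num) (by norm_num)
  set M : ℝ := C * (2048 * Rad / d + 3) * (1024 * ε₀ / d) ^ α with hM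
  have hq0 : 0 < 1024 * ε₀ / d := by positivity
  have hq1 : 1024 * ε₀ / d ≤ 1 := by rw [div_le_one hd]; exact hε₀d
  ---------------------------------------------------------------- the real bound
  have hreal : ∀ k, ((2 * N k + 1 : ℕ) : ℝ) * (C * (1024 * ε k / d) ^ (1 + α)) ≤ M * x k ^ α := by
    intro k
    have hεk : ε k = ε₀ * x k := by simp only [hε k, hx]
    have hεpos : 0 < ε k := by rw [hεk]; exact mul_pos hε₀ (hx0 k)
    have hεle : ε k ≤ ε₀ := by rw [hεk]; exact mul_le_of_le_one_right hε₀.le (hx1 k)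
    -- `2N + 1 ≤ 2 Rad/ε + 3`
    have ha : ((2 * N k + 1 : ℕ) : ℝ) ≤ 2 * Rad / ε k + 3 := by
      have h1 : (⌈Rad / ε k⌉₊ : ℝ) < Rad / ε k + 1 := Nat.ceil_lt_add_one (div_nonneg hRad hεpos.le)
      rw [hN k]; push_cast
      have : 2 * Rad / ε k = 2 * (Rad / ε k) := by ring
      rw [this]; linarith
    -- `(1024 ε/d)^{1+α} = (1024 ε/d) (1024 ε/d)^α ≤ (1024 ε /d) (1024 ε₀/d)^α x^α`
    have hb0 : 0 < 1024 * ε k / d := by positivity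
    have hb : (1024 * ε k / d) ^ (1 + α) = (1024 * ε k / d) * ((1024 * ε₀ / d) ^ α * x k ^ α) := by
      rw [Real.rpow_add hb0, Real.rpow_one, ← Real.mul_rpow hq0.le (hx0 k).le]
      congr 2
      rw [hεk]; ring
    have hprod : (2 * Rad / ε k + 3) * (1024 * ε k / d) ≤ 2048 * Rad / d + 3 := by
      have e1 : (2 * Rad / ε k + 3) * (1024 * ε k / d) = 2048 * Rad / d + 3072 * ε k / d := by
        field_simp
        ring
      rw [e1]
      have : 3072 * ε k / d ≤ 3 := by
        rw [div_le_iff₀ hd]; nlinarith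
      linarith
    have hpow0 : 0 ≤ (1024 * ε₀ / d) ^ α * x k ^ α := by positivity
    calc ((2 * N k + 1 : ℕ) : ℝ) * (C * (1024 * ε k / d) ^ (1 + α))
        = C * ((((2 * N k + 1 : ℕ) : ℝ) * (1024 * ε k / d)) * ((1024 * ε₀ / d) ^ α * x k ^ α)) := by
          rw [hb]; ring
      _ ≤ C * (((2 * Rad / ε k + 3) * (1024 * ε k / d)) * ((1024 * ε₀ / d) ^ α * x k ^ α)) := by
          gcongr
      _ ≤ C * ((2048 * Rad / d + 3) * ((1024 * ε₀ / d) ^ α * x k ^ α)) := by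
          gcongr
      _ = M * x k ^ α := by rw [hM]; ring
  ---------------------------------------------------------------- the limit
  have hr1 : (1 / 2 : ℝ) ^ α < 1 := Real.rpow_lt_one (by norm_num) (by norm_num) hα
  have hr0 : 0 ≤ (1 / 2 : ℝ) ^ α := Real.rpow_nonneg (by norm_num) _
  have hxα : ∀ k, x k ^ α = ((1 / 2 : ℝ) ^ α) ^ k := fun k => by
    simp only [hx]
    rw [← Real.rpow_natCast_mul (by norm_num : (0 : ℝ) ≤ 1 / 2), mul_comm,
      Real.rpow_mul_natCast (by norm_num : (0 : ℝ) ≤ 1 / 2)]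
  have hlim : Tendsto (fun k => ENNReal.ofReal (M * x k ^ α)) atTop (𝓝 0) := by
    rw [← ENNReal.ofReal_zero]
    refine ENNReal.tendsto_ofReal ?_
    have h := (tendsto_pow_atTop_nhds_zero_of_lt_one hr0 hr1).const_mul M
    rw [mul_zero] at h
    exact h.congr fun k => by rw [hxα]
  refine tendsto_of_tendsto_of_tendsto_of_le_of_le tendsto_const_nhds hlim (fun k => bot_le)
    fun k => ?_
  have hnn : (0 : ℝ) ≤ ((2 * N k + 1 : ℕ) : ℝ) := Nat.cast_nonneg _
  calc ((2 * N k + 1 : ℕ) : ℝ≥0∞) * ENNReal.ofReal (C * (1024 * ε k / d) ^ (1 + α))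
      = ENNReal.ofReal (((2 * N k + 1 : ℕ) : ℝ) * (C * (1024 * ε k / d) ^ (1 + α))) := by
        rw [ENNReal.ofReal_mul hnn, ENNReal.ofReal_natCast]
    _ ≤ ENNReal.ofReal (M * x k ^ α) := ENNReal.ofReal_le_ofReal (hreal k)

/-- **Registered sub-stub `stub_noTouch_windows`** (line `hitting-tournament`, stubs
`stub_quadTransfer_noTouchRe` / `stub_quadTransfer_noTouchIm`, helper 4): `exists_int_window`
with all arguments explicit. [folklore] -/
theorem stub_noTouch_windows : ∀ (u : ℂ), ‖u‖ = 1 → ∀ (a ε Rad : ℝ), 0 < ε → ∀ (z : ℂ), |(starRingEnd ℂ u * z).re - a| < ε → ‖z‖ < Rad → ∀ (N : ℕ), Rad / ε ≤ N → ∃ i : ℤ, -(N : ℤ) ≤ i ∧ i ≤ N ∧ dist z (u * ((a : ℂ) + (((i : ℝ) * ε : ℝ) : ℂ) * Complex.I)) < 2 * ε :=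
  fun _ hu _ _ _ hε _ hz hzR _ hN => exists_int_window hu hε hz hzR hN

end Summit.CriticalPhenomena.CardyFormulaZ2.Cruxes.LagHandOff.HittingTournament

end
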